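/-
Copyright (c) 2026 the pub-hodgecm-mathlib formalisation cell (harness21).  Prover seat hodgecm-mathlib-LH4-p01 (g10): road M6 → F3 «TOT-Λ BY OVER-ORDERS» (LEAD F0P3a-plan
T14-66), carve (c5-ii) «MODEL PACKAGE SELECTION» (F3-5 pen LH7-p04 (g12)), FILE C-W «THE θ-PACKAGE OF THE WILD UNIT-DISCRIMINANT ROW»; 2026-09-03.
-/
import Literature.NumberTheory.NumberFields.RamifiedQuadraticDictionaryWild       -- ★ (P1b) (B-p08 (g40)): (L1u) `exists_sqrt_and_coord_of_wildUnit`, (L2u) `exists_involutions_of_wildUnit`; brings ★ [T2-L] (L3) `exists_mul_map_eq_of_ramified`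
import Literature.NumberTheory.Rogawski1990.InertPlaceThetaPackageUniformiser     -- ★ (c5-ii) C p853143 (this seat): `exists_isUnit_moved_by_galAdicCompletionMap` (`hmove`); brings ★ (D5)'s place dictionary and ★ (D3) §1 `valuation_map_eq_of_involutive`
import HarnessLib

/-!
# The θ-package of the wild unit-discriminant row at an inert place: `θ = (α − 1)∕ι₁ϖ^k`, `α² = ι₁(1 + w₀)`, Eisenstein pair `(−2∕ϖ^k, w₀∕ϖ^{2k})`, `s̃ ⊃ σ_w` fixing `θ`
# (Serre, Corps locaux I §6, V §2; O'Meara §63A; Neukirch II (8.2)–(8.3))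

Topic `NumberTheory/Rogawski1990`; namespace `Literature.NumberTheory.Rogawski1990`.  ONE THEOREM + one lemma (no definition, no instance, no notation, no named fact, no `sorry`);
kernel lane `--supports stmt-HodgeConjecture-24833`.  Cell `pub/hodgecm-mathlib` (D-0151), crux H413 = `stmt-HodgeConjecture-24833`; road M6 → F3 «TOT-Λ by over-orders» (route (B));
carve **(c5-ii) «MODEL PACKAGE SELECTION», FILE C-W**: the INPUT package of ★ FILE A `InertPlaceIntegralEisensteinFrame.exists_integralEisensteinFrame_inertPlace` (p853133) for
the WILD UNIT-DISCRIMINANT row — `K = M_{w₁} = E_w(α)`, `α² = d = 1 + w₀`, `|4| < |w₀| = |ϖ|^{2k+1}` (so `k < e = ord_w 2`), Eisenstein uniformiser `θ := (α − 1)∕ι₁ϖ^k` with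
`θ² = ι₁(−2∕ϖ^k)·θ + ι₁(w₀∕ϖ^{2k})` — produced EIGEN-DATA-FREE from ★ (P1b) `RamifiedQuadraticDictionaryWild` (L1u)(L2u) + ★ [T2-L] (L3), exactly as ★ FILE C
`InertPlaceThetaPackageUniformiser` (p853143) does for the uniformiser row from ★ [T2-L] (L1)(L2)(L3); the twin of the frame half of ★ (D2-β)′
`TypeTwoEigenFieldPackageWild.exists_eigenField_package_wildUnit` (which carries the eigen-data and the deep binders).  So F3-5b-III instantiates FILE A on BOTH dyadic rows
(and the tame row) by two calls each.
HONEST LABEL: HC_CM is proved only modulo the 7 printed citations (2 remaining named inputs: hLiu418 = stmt-HodgeConjecture-24832, h413 = stmt-HodgeConjecture-24833) until rung 0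
closes; unconditional local algebra at a place, count-neutral (pays no organ, opens no road; zero label movement until F5 ★ + a desk-priced rider).

THE MATHEMATICS.  With `π := ι₁ϖ` and `α = 1 + π^k θ`: `α² = 1 + ι₁w₀` gives `π^{2k}θ² + 2π^kθ = ι₁w₀`, i.e. `θ² = (−2∕π^k)·θ + ι₁w₀∕π^{2k}` — an Eisenstein relation whose
coefficients `a := −2∕ϖ^k`, `k₀ := w₀∕ϖ^{2k}` are `σ_w`-fixed elements of `E_w` (as `ϖ`, `w₀` are), hence come from `F_v` (`ι_w` onto the fixed field, isometric at the
unramified `v`), with `|k₀| = |w₀|·|ϖ|^{−2k} = exp(−1)` and `|a|² = |4|·|ϖ|^{−2k} < |w₀|·|ϖ|^{−2k} = exp(−1) < 1`, so `|a| < 1` (no `|2|` token: only `|4| < |w₀|`).  The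
involution `s̃` of ★ (L2u) fixes `α` and `ι₁ϖ`, hence `θ`; it is integral, hence isometric; `s̃`-fixed units are norms (★ (L3) from `hmove`, ★ FILE C), hence the (nK) clause
by the `θ^{2k}` reduction (`|θ| = exp(−1)`).  [cite: SerreLocalFields1979, Ch. I §6 Prop. 17–18; Ch. V §2 Prop. 3 and Cor.] [cite: Omeara1963, §63A] [cite: Neukirch1999, Ch. II (8.2)–(8.3), §4 Prop. (4.3)]

* §1 `v_lt_one_of_sq_lt_one` (`x² < 1 ⇒ x < 1` in the value group);
* §2 **`exists_thetaPackage_wildUnitRow`** — `∃ aF k₀ θ s̃` with FILE A's input letters VERBATIM (`haF hk₀ hθ hcoord hint hs′ι hs′θ hs′O hs′v hnorm1`) + `ι_w aF = −2∕ϖ^k`,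
  `ι_w k₀ = w₀∕ϖ^{2k}`, `θ = (α − 1)∕ι₁ϖ^k`, `α² = ι₁d`, `|θ| = exp(−1)`, `s̃ s̃ = id`.

## References
* [SerreLocalFields1979] J.-P. Serre, *Local Fields*, GTM 67 (1979): Ch. I §6 Prop. 17–18; Ch. V §2 Prop. 3 and Corollary.
* [Omeara1963] O. T. O'Meara, *Introduction to Quadratic Forms*, Grundlehren 117 (1963): §63A (local square classes near `1`, the unit `1 + w₀` with `|4| < |w₀| < 1`).
* [Neukirch1999] J. Neukirch, *Algebraic Number Theory*, Grundlehren 322 (1999): Ch. II (8.2)–(8.3), §4 Prop. (4.3).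
* [Rogawski1990] J. D. Rogawski, *Automorphic Representations of Unitary Groups in Three Variables*, Ann. of Math. Stud. 123 (1990): §4.9 Lemma 4.9.3 p. 56.
-/

set_option autoImplicit false

noncomputable section

open ValuativeRel NumberField IsDedekindDomain
open scoped ValuativeRel
open Literature.NumberTheory.Automorphic Literature.NumberTheory.Automorphic.UnitaryGroup Literature.NumberTheory.NumberFields

namespace Literature.NumberTheory.Rogawski1990

/-! ## §1 A value-group lemma -/

/-- In a linearly ordered commutative group with zero, `x·x < 1 ⇒ x < 1`. [cite: SerreLocalFields1979, Ch. I §6] -/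
theorem v_lt_one_of_sq_lt_one {Γ : Type*} [LinearOrderedCommGroupWithZero Γ] {x : Γ} (h : x * x < 1) : x < 1 := by
  by_contra hx
  rw [not_lt] at hx
  exact absurd h (not_lt.2 (by simpa using mul_le_mul' hx hx))

/-! ## §2 The θ-package of the wild unit-discriminant row -/

set_option maxHeartbeats 4000000 in
/-- **(c5-ii-C-W) THE θ-PACKAGE OF THE WILD UNIT-DISCRIMINANT ROW AT AN INERT PLACE.**  `E ∕ F` quadratic number fields, `c ≠ 1`, `v` unramified, `w ∣ v`, `c • w = w`; an auxiliary
quadratic `M ⊃ E` (`σ_M δ = −δ`, `m = δ²`) with `d⁻¹m` a square in `E_w` for the WILD UNIT `d = 1 + w₀ ∈ E_w`, `|w₀| = exp(−(2k+1))`, `|4| < |w₀|`, `ϖ` a uniformiser of `E_w`, and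
`d`, `ϖ` fixed by `σ_w`; `w₁ ∣ w`.  THEN there are `aF k₀ ∈ F_v`, `θ ∈ M_{w₁}`, `s̃ : M_{w₁} →+* M_{w₁}` with: `ι_w aF = −2∕ϖ^k`, `ι_w k₀ = w₀∕ϖ^{2k}`, `|aF| < 1`, `|k₀| = exp(−1)`,
`θ = (α − 1)∕ι₁ϖ^k` for an `α` with `α² = ι₁ d`, `|θ| = exp(−1)`, and ALL the input letters of ★ FILE A `exists_integralEisensteinFrame_inertPlace` at `(aF, k₀)`:
`θ² = ι₁ι(aF)·θ + ι₁ι(k₀)`, unique coordinates, integrality criterion, `s̃ ∘ ι₁ = ι₁ ∘ σ_w`, `s̃θ = θ`, `s̃s̃ = id`, `s̃𝒪 ⊆ 𝒪`, isometry, (nK).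
[cite: SerreLocalFields1979, Ch. I §6 Prop. 17–18; Ch. V §2 Prop. 3 and Cor.] [cite: Omeara1963, §63A] [cite: Neukirch1999, Ch. II (8.2)–(8.3), §4 Prop. (4.3)] -/
theorem exists_thetaPackage_wildUnitRow
    {F E : Type} [Field F] [NumberField F] [Field E] [NumberField E] [Algebra F E] [Algebra.IsQuadraticExtension F E]
    (c : E ≃ₐ[F] E) (v : HeightOneSpectrum (𝓞 F)) (hc : c ≠ 1) (hunr : Algebra.IsUnramifiedIn (𝓞 E) v.asIdeal)
    (w : PlacesOver E v) (hw : c • w.1 = w.1)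
    {M : Type} [Field M] [NumberField M] [Algebra E M] [Algebra.IsQuadraticExtension E M] (σM : M ≃ₐ[E] M) {δ : M} (hσδ : σM δ = -δ) (hδ : δ ≠ 0)
    {m : E} (hm : algebraMap E M m = δ ^ 2)
    {d w₀ : w.1.adicCompletion E} (hdw : d = 1 + w₀) {k : ℕ} (hw₀ : Valued.v w₀ = WithZero.exp (-(2 * (k : ℤ) + 1)))
    (h4 : Valued.v (4 : w.1.adicCompletion E) < Valued.v w₀) (hdm : IsSquare (d⁻¹ * (m : w.1.adicCompletion E)))
    {ϖ : w.1.adicCompletion E} (hϖ : Valued.v ϖ = WithZero.exp (-1 : ℤ))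
    (hσd : galAdicCompletionMap (L := E) c hw d = d) (hσϖ : galAdicCompletionMap (L := E) c hw ϖ = ϖ) (w₁ : PlacesOver M w.1) :
    ∃ (aF k₀ : v.adicCompletion F) (θ : w₁.1.adicCompletion M) (s' : w₁.1.adicCompletion M →+* w₁.1.adicCompletion M),
      toPlace v w aF = -2 / ϖ ^ k ∧ toPlace v w k₀ = w₀ / ϖ ^ (2 * k) ∧ Valued.v aF < 1 ∧ Valued.v k₀ = WithZero.exp (-1 : ℤ) ∧
      (∃ α : w₁.1.adicCompletion M, α ^ 2 = toPlace w.1 w₁ d ∧ θ = (α - 1) / toPlace w.1 w₁ ϖ ^ k) ∧ Valued.v θ = WithZero.exp (-1 : ℤ) ∧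
      θ ^ 2 = toPlace w.1 w₁ (toPlace v w aF) * θ + toPlace w.1 w₁ (toPlace v w k₀) ∧
      (∀ z : w₁.1.adicCompletion M, ∃! pq : w.1.adicCompletion E × w.1.adicCompletion E, z = toPlace w.1 w₁ pq.1 + toPlace w.1 w₁ pq.2 * θ) ∧
      (∀ p q : w.1.adicCompletion E, toPlace w.1 w₁ p + toPlace w.1 w₁ q * θ ∈ 𝒪[w₁.1.adicCompletion M] ↔ p ∈ 𝒪[w.1.adicCompletion E] ∧ q ∈ 𝒪[w.1.adicCompletion E]) ∧
      (∀ x, s' (toPlace w.1 w₁ x) = toPlace w.1 w₁ (galAdicCompletionMap (L := E) c hw x)) ∧ s' θ = θ ∧ (∀ z, s' (s' z) = z) ∧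
      (∀ z : 𝒪[w₁.1.adicCompletion M], s' z ∈ 𝒪[w₁.1.adicCompletion M]) ∧ (∀ z, Valued.v (s' z) = Valued.v z) ∧
      (∀ c₁ : w₁.1.adicCompletion M, c₁ ≠ 0 → s' c₁ = c₁ → Even (WithZero.log (Valued.v c₁)) → ∃ a : w₁.1.adicCompletion M, a * s' a * c₁ = 1) := by
  set s := galAdicCompletionMap (L := E) c hw with hsdef
  set ι₁ := toPlace w.1 w₁ with hι₁def
  have hσv : ∀ x : w.1.adicCompletion E, Valued.v (s x) = Valued.v x := fun x => valued_galAdicCompletionMap (L := E) c hw x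
  have hss : ∀ x, s (s x) = x := galAdicCompletionMap_galAdicCompletionMap_of_smul_eq c w hc hw
  have hsO : ∀ x : 𝒪[w.1.adicCompletion E], s x ∈ 𝒪[w.1.adicCompletion E] := fun x => mem_integer_galAdicCompletionMap c v w hw x
  have hιv : ∀ y : v.adicCompletion F, Valued.v (toPlace v w y) = Valued.v y :=
    fun y => Literature.NumberTheory.Automorphic.Liu2021.LemD1IndexedNonVacuityInertCofinite.valued_toPlace_of_isUnramifiedIn E v hunr w y
  have hϖ0 : ϖ ≠ 0 := fun h0 => by rw [h0, map_zero] at hϖ; exact WithZero.coe_ne_zero hϖ.symm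
  have hπ0 : ι₁ ϖ ≠ 0 := (map_ne_zero ι₁).2 hϖ0
  -- ### 1. The Eisenstein pair `(a, k₀) = (−2∕ϖ^k, w₀∕ϖ^{2k})` of `E_w`, `σ_w`-fixed, descended to `F_v`
  have hσw₀ : s w₀ = w₀ := by
    have h : s d = d := hσd
    rw [hdw, map_add, map_one] at h
    exact add_left_cancel h
  have hσaE : s (-2 / ϖ ^ k) = -2 / ϖ ^ k := by rw [map_div₀, map_neg, map_ofNat, map_pow, hσϖ]
  have hσkE : s (w₀ / ϖ ^ (2 * k)) = w₀ / ϖ ^ (2 * k) := by rw [map_div₀, map_pow, hσw₀, hσϖ]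
  obtain ⟨aF, haF⟩ := exists_toPlace_eq_of_galAdicCompletionMap_eq c w hc hw _ hσaE
  obtain ⟨k₀, hk₀⟩ := exists_toPlace_eq_of_galAdicCompletionMap_eq c w hc hw _ hσkE
  have hsmul : ∀ m : ℕ, m • (-1 : ℤ) = -(m : ℤ) := fun m => by simp
  have hϖpow : ∀ m : ℕ, Valued.v (ϖ ^ m) = WithZero.exp (-(m : ℤ)) := fun m => by rw [map_pow, hϖ, ← WithZero.exp_nsmul, hsmul]
  have hk₀v : Valued.v k₀ = WithZero.exp (-1 : ℤ) := by
    rw [← hιv, hk₀, map_div₀, hw₀, hϖpow, ← WithZero.exp_sub]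
    congr 1; push_cast; ring
  have haFv : Valued.v aF < 1 := by
    rw [← hιv, haF]
    apply v_lt_one_of_sq_lt_one
    have h2 : Valued.v (-2 / ϖ ^ k) * Valued.v (-2 / ϖ ^ k) = Valued.v (4 : w.1.adicCompletion E) * WithZero.exp (2 * (k : ℤ)) := by
      rw [← map_mul, show (-2 / ϖ ^ k) * (-2 / ϖ ^ k) = (4 : w.1.adicCompletion E) / ϖ ^ (2 * k) by rw [pow_mul']; ring, map_div₀, hϖpow,
        div_eq_mul_inv, ← WithZero.exp_neg]
      congr 2; push_cast; ring
    rw [h2]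
    calc Valued.v (4 : w.1.adicCompletion E) * WithZero.exp (2 * (k : ℤ))
        < Valued.v w₀ * WithZero.exp (2 * (k : ℤ)) := mul_lt_mul_of_pos_right h4 (WithZero.exp_pos)
      _ = WithZero.exp (-1 : ℤ) := by rw [hw₀, ← WithZero.exp_add]; congr 1; ring
      _ < 1 := by rw [← WithZero.exp_zero]; exact WithZero.exp_lt_exp.2 (by norm_num)
  -- ### 2. ★ (L1u), (L2u): `α`, the uniformiser `θ = (α − 1)∕ι₁ϖ^k`, the involution `s̃`
  obtain ⟨α, hα, hαv, hθv, hcoord, hint⟩ := exists_sqrt_and_coord_of_wildUnit M w.1 σM hσδ hδ hm hdw hw₀ h4 hdm hϖ w₁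
  obtain ⟨⟨s', hs'ι, hs'α, hs's', hs'O⟩, -⟩ := exists_involutions_of_wildUnit M w.1 σM hσδ hδ hm hdw hw₀ h4 hdm hϖ w₁ s hss hσd hσϖ hsO hα
  set θ : w₁.1.adicCompletion M := (α - 1) / toPlace w.1 w₁ ϖ ^ k with hθdef
  have hs'θ : s' θ = θ := by
    rw [hθdef, map_div₀, map_sub, map_one, map_pow, hs'α, hs'ι, hσϖ]
  -- the Eisenstein relation `θ² = ι₁(−2∕ϖ^k)·θ + ι₁(w₀∕ϖ^{2k})`
  have hα' : α ^ 2 = 1 + ι₁ w₀ := by rw [hα, hdw, map_add, map_one]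
  have hθsq : θ ^ 2 = toPlace w.1 w₁ (toPlace v w aF) * θ + toPlace w.1 w₁ (toPlace v w k₀) := by
    have hnum : (α - 1) ^ 2 = -2 * (α - 1) + ι₁ w₀ := by linear_combination hα'
    have hden : ι₁ ϖ ^ k * ι₁ ϖ ^ k = ι₁ ϖ ^ (2 * k) := by rw [two_mul, pow_add]
    rw [haF, hk₀, ← hι₁def, map_div₀, map_div₀, map_neg, map_ofNat, map_pow, map_pow, hθdef, ← hι₁def, div_pow, div_mul_div_comm, hden,
      ← add_div, ← pow_mul, mul_comm k 2, hnum]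
  -- ### 3. isometry of `s̃`, `hmove`, ★ (L3) unit norms, and the (nK) clause by the `θ^{2k}` reduction (as ★ FILE C)
  have hs'val : ∀ z, valuation (w₁.1.adicCompletion M) (s' z) = valuation (w₁.1.adicCompletion M) z :=
    Literature.NumberTheory.Automorphic.valuation_map_eq_of_involutive s' hs's' hs'O
  have hs'v : ∀ z, Valued.v (s' z) = Valued.v z := fun z => (v_eq_iff_valuation_eq _ _).2 (hs'val z)
  have hmove := exists_isUnit_moved_by_galAdicCompletionMap c v hc hunr w hw
  have hnormU : ∀ u : 𝒪[w₁.1.adicCompletion M], IsUnit u → s' u = u → ∃ t : 𝒪[w₁.1.adicCompletion M], (t : w₁.1.adicCompletion M) * s' t = u :=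
    fun u hu hsu => exists_mul_map_eq_of_ramified M w.1 w₁ s hmove s' hs'ι hs's' hs'O u hu hsu
  have hθ0 : θ ≠ 0 := fun h0 => by rw [h0, map_zero] at hθv; exact WithZero.coe_ne_zero hθv.symm
  have hnorm1 : ∀ c₁ : w₁.1.adicCompletion M, c₁ ≠ 0 → s' c₁ = c₁ → Even (WithZero.log (Valued.v c₁)) →
      ∃ a : w₁.1.adicCompletion M, a * s' a * c₁ = 1 := by
    intro c₁ hc0 hsc ⟨j, hj⟩
    have hvc0 : Valued.v c₁ ≠ 0 := (Valuation.ne_zero_iff _).2 hc0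
    have hu₀v : Valued.v (c₁ * θ ^ (j + j)) = 1 := by
      rw [map_mul, map_zpow₀, hθv, ← WithZero.exp_zsmul, ← WithZero.exp_log hvc0, hj, ← WithZero.exp_add, ← WithZero.exp_zero]
      congr 1; simp only [smul_eq_mul]; ring
    have hu₀O : c₁ * θ ^ (j + j) ∈ 𝒪[w₁.1.adicCompletion M] := (mem_integer_iff_valued_le_one _).2 hu₀v.le
    have hu₀ne : c₁ * θ ^ (j + j) ≠ 0 := mul_ne_zero hc0 (zpow_ne_zero _ hθ0)
    have hu₀u : IsUnit (⟨c₁ * θ ^ (j + j), hu₀O⟩ : 𝒪[w₁.1.adicCompletion M]) := by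
      have hinvO : (c₁ * θ ^ (j + j))⁻¹ ∈ 𝒪[w₁.1.adicCompletion M] := (mem_integer_iff_valued_le_one _).2 (by rw [map_inv₀, hu₀v, inv_one])
      exact IsUnit.of_mul_eq_one ⟨_, hinvO⟩ (Subtype.ext (mul_inv_cancel₀ hu₀ne))
    have hsu₀ : s' ((⟨c₁ * θ ^ (j + j), hu₀O⟩ : 𝒪[w₁.1.adicCompletion M]) : w₁.1.adicCompletion M) = c₁ * θ ^ (j + j) := by
      change s' (c₁ * θ ^ (j + j)) = _
      rw [map_mul, map_zpow₀, hsc, hs'θ]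
    obtain ⟨t₀, ht₀⟩ := hnormU _ hu₀u hsu₀
    have ht₀' : (t₀ : w₁.1.adicCompletion M) * s' t₀ = c₁ * θ ^ (j + j) := ht₀
    have ht₀0 : (t₀ : w₁.1.adicCompletion M) ≠ 0 := by
      intro h0
      rw [h0, zero_mul] at ht₀'
      exact hu₀ne ht₀'.symm
    have hs't₀0 : s' (t₀ : w₁.1.adicCompletion M) ≠ 0 := (map_ne_zero s').2 ht₀0
    refine ⟨θ ^ j * (t₀ : w₁.1.adicCompletion M)⁻¹, ?_⟩
    rw [map_mul, map_zpow₀, hs'θ, map_inv₀]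
    calc θ ^ j * (t₀ : w₁.1.adicCompletion M)⁻¹ * (θ ^ j * (s' (t₀ : w₁.1.adicCompletion M))⁻¹) * c₁
        = (c₁ * θ ^ (j + j)) * ((t₀ : w₁.1.adicCompletion M) * s' t₀)⁻¹ := by rw [zpow_add₀ hθ0, mul_inv]; ring
      _ = 1 := by rw [← ht₀', mul_inv_cancel₀ (mul_ne_zero ht₀0 hs't₀0)]
  exact ⟨aF, k₀, θ, s', haF, hk₀, haFv, hk₀v, ⟨α, hα, rfl⟩, hθv, hθsq, hcoord, hint, hs'ι, hs'θ, hs's', hs'O, hs'v, hnorm1⟩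

end Literature.NumberTheory.Rogawski1990

end
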